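import Mathlib
import Literature.Barriers.ValiantsHypothesis.AlgebraicNaturalProofs
import Literature.Computability.AlgebraicComplexity.ArithCircuitProofs
import Literature.Computability.AlgebraicComplexity.RazUniversalCircuits
import Summits.ValiantsHypothesis.ValiantsHypothesis.Theorems.DivisionGapZeroOneTransferStubSqrtCheap
import Summits.ValiantsHypothesis.ValiantsHypothesis.Theorems.BarrierLeverSuccinctHittingSetsForVPLowDegree
import Summits.ValiantsHypothesis.ValiantsHypothesis.Theorems.BarrierLeverSuccinctHittingSetsForVPDimensionCount
import HarnessLib

/-!
# Crux `BarrierLever.SuccinctHittingSetsForVP` (stmt-ValiantsHypothesis-14610), line `registered` —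
EQUATIONS OF POLYNOMIAL DEGREE FOR SMALL CIRCUITS EXIST (the obstruction in the open stub
`stub_levelOne` is the SIZE of the distinguisher, not its degree)

**What is proved (unconditional; structure of the open stub, it does NOT close the item).** In FSV's
framework over `ℂ` (tree regime `d = n`, coefficient variables `degLEMonomials n`, `N = C(2n,n)` of
them, simple class `SmallCircuits ℂ n b = {f : deg f ≤ n, L(f) ≤ n ^ b}`):

* `LowDegreeEquations.exists_equation` / registered stub `stub_lowDegreeEquations` : for every `b`
  there are `c, n₀` such that for all `n ≥ n₀` some NONZERO `D` of total degree `≤ n ^ c` — and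
  (`exists_equation`) of fan-in-two size `L(D) ≤ 2 ^ (n ^ c)`, i.e. QUASI-POLYNOMIAL `N^{polylog N}`
  in `N = C(2n,n) ≥ 2^n`, the trivial sparse bound — vanishes at `coeff(f)` for every
  `f ∈ SmallCircuits ℂ n b`;
* `exists_isNaturalProof_lowDegree` : i.e. algebraically natural proofs against `SmallCircuits ℂ n b`
  of polynomial DEGREE exist (FSV Def. 1 with `𝒟` = "degree `≤ n^c`", no size bound), and
  `SmallCircuits ℂ n b` is not a succinct hitting set for that class (FSV Thm. 4);
* `exists_equation_degree_le_choose`, `not_levelOne_without_size_bound` : in particular the degree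
  allowance `deg D ≤ N` of the level-one distinguishers is met by such equations, so the open stub
  `stub_levelOne` (= FSV Question 6 at level one, crux ↔ level one by the landed level collapse)
  becomes FALSE when the size bound `L(D) ≤ N` is dropped: every proof of it must use the size
  bound, every disproof must bound the size of an equation (cf. CKRST 2020 over finite fields).

Together with the companion file `…LowDegree.lean` (equations need degree `> n^(b-2)`; distinguishers
of degree `≤ n^c` ARE hit by `SmallCircuits ℂ n (c+2)`) this brackets the degree of equations for
size-`n^b` circuits between `n^(b-2)` and `n^(10b+41)` and isolates circuit SIZE as the entire content
of the open problem in the tree's regime.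

**Proof.** (1) For `f ∈ SmallCircuits ℂ n b` the top homogeneous component `f_n` has
`L(f_n) ≤ s = (n+1)(n^b + n + 2)` (interpolation, `SqrtCheap.complexity_homogeneousComponent_le`) and
the same degree-`n` coefficients. (2) By Raz's universal circuit-graph in the tree
(`RazUniversal.exists_eval_uCoeff_eq_coeff`, Raz 2010 Prop. 3.3; slots `W = 4 s (n+1)²`), the
degree-`n` coefficient vector of `f_n` is `Γ(y)` for some labelling `y` of its `p ≤ 9375 (n+3)^(5b+20)`
edges, the coordinates `Γ_e` being label-polynomials of degree `≤ 2n - 1`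
(`RazUniversal.totalDegree_uCoeff_le`). (3) Dimension count (`LowDegreeEquations.exists_ne_zero_aeval_eq_zero`, companion file
`…DimensionCount.lean`): pick
`p²` distinct degree-`n` monomials (there are `≥ 2^(n-1) ≥ p²` for `n ≫ 0`,
`exists_injective_degree_eq`, `eventually_mul_pow_le_two_pow`); the multilinear polynomials in the
corresponding `p²` coefficient variables form a space of dimension `2^(p²)` (`nat_card_boxOne`) that
the substitution `c_e ↦ Γ_e` maps linearly into label-polynomials of degree `≤ p²(2n-1)`, a space of
dimension `≤ (p²(2n-1)+1)^p < 2^(p²)` (`key_ineq`: `p²(2n-1)+1 ≤ p³ < 2^p`); a nonzero kernel element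
`D₀` (`LinearMap.ker_ne_bot_of_finrank_lt`) has total degree `≤ p² ≤ n^(10b+41)` and
`D := rename D₀` vanishes at `coeff(f)`: `D(coeff f) = D₀(Γ(y)) = (D₀ ∘ Γ)(y) = 0`; it has
`≤ (p²+1)^(p²)` monomials, whence the size bound (`complexity_le_of_totalDegree_le`, `size_arith`).
So in the tree's regime the known UPPER bound for the constructivity of equations for size-`n^b`
circuits is quasi-polynomial in `N` and the open stub asks for polynomial.
Axioms: `propext`, `Classical.choice`, `Quot.sound`.

References: [ForbesShpilkaVolk2018] Def. 1, Thm. 4, §1.1 ("non-natural" existence of equations by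
dimension counting is folklore there and in [GrochowKumarSaksSaraf2017] §1), Question 6;
[Raz2010] Prop. 3.2–3.3 (universal circuit and the polynomial map `Γ`).
-/

-- layout Summits/ValiantsHypothesis/ValiantsHypothesis forces the duplicated namespace component
set_option linter.dupNamespace false

namespace Summit.ValiantsHypothesis.ValiantsHypothesis.Theorems.BarrierLever.SuccinctHittingSetsForVP

open Literature.Barriers.ValiantsHypothesis Literature.Computability.AlgebraicComplexity MvPolynomial

namespace LowDegreeEquations

/-! ### Arithmetic of the parameters -/

/-- `n ^ b + n + 2 ≤ (n + 3) ^ (b + 1)`. [folklore] -/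
theorem base_le (n b : ℕ) : n ^ b + n + 2 ≤ (n + 3) ^ (b + 1) := by
  have h1 : n ^ b ≤ (n + 3) ^ b := Nat.pow_le_pow_left (by omega) b
  have h2 : 1 ≤ (n + 3) ^ b := Nat.one_le_pow _ _ (by omega)
  calc n ^ b + n + 2 ≤ (n + 3) ^ b + (n + 3) ^ b * (n + 2) := by nlinarith
    _ = (n + 3) ^ (b + 1) := by ring

/-- The slot parameter of the universal circuit used below: `W = 4 s (n+1)²` with
`s = (n+1)(n^b + n + 2)` (the complexity bound for top homogeneous components of members of
`SmallCircuits ℂ n b`); the quantity `2n + W + 1` entering `RazUniversal.card_lab_le` is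
`≤ 5 (n+3)^(b+4)`. [folklore] -/
theorem slots_le (n b : ℕ) :
    n + n + 4 * ((n + 1) * (n ^ b + n + 2)) * (n + 1) ^ 2 + 1 ≤ 5 * (n + 3) ^ (b + 4) := by
  have hB := base_le n b
  have h3 : (n + 1) ^ 3 ≤ (n + 3) ^ 3 := Nat.pow_le_pow_left (by omega) 3
  have hW : 4 * ((n + 1) * (n ^ b + n + 2)) * (n + 1) ^ 2 ≤ 4 * (n + 3) ^ (b + 4) := by
    calc 4 * ((n + 1) * (n ^ b + n + 2)) * (n + 1) ^ 2 = 4 * ((n + 1) ^ 3 * (n ^ b + n + 2)) := by ring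
      _ ≤ 4 * ((n + 3) ^ 3 * (n + 3) ^ (b + 1)) := by gcongr
      _ = 4 * (n + 3) ^ (b + 4) := by ring
  have hlin : n + n + 1 ≤ (n + 3) ^ (b + 4) := by
    calc n + n + 1 ≤ (n + 3) ^ 2 := by nlinarith
      _ ≤ (n + 3) ^ (b + 4) := Nat.pow_le_pow_right (by omega) (by omega)
  omega

/-- **The label count is polynomial**: with the parameters above, the number `p` of edge labels of
Raz's universal circuit-graph satisfies `p ≤ 9375 (n+3)^(5b+20)`. [cite: Raz2010, Prop. 3.3 (p. 158)] -/
theorem card_lab_le_poly (n b : ℕ) :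
    Fintype.card (RazUniversal.Lab (Fin n) n (4 * ((n + 1) * (n ^ b + n + 2)) * (n + 1) ^ 2)) ≤
      9375 * (n + 3) ^ (5 * b + 20) := by
  refine (RazUniversal.card_lab_le (Fin n) n _).trans ?_
  rw [Fintype.card_fin]
  calc 3 * (n + n + 4 * ((n + 1) * (n ^ b + n + 2)) * (n + 1) ^ 2 + 1) ^ 5
      ≤ 3 * (5 * (n + 3) ^ (b + 4)) ^ 5 := by gcongr; exact slots_le n b
    _ = 9375 * (n + 3) ^ (5 * b + 20) := by rw [mul_pow, ← pow_mul]; ring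

/-- … and for `n ≥ 3` its square is `≤ 10^8 · 2^(10b+40) · n^(10b+40)`. [folklore] -/
theorem card_lab_sq_le (n b : ℕ) (hn : 3 ≤ n) :
    Fintype.card (RazUniversal.Lab (Fin n) n (4 * ((n + 1) * (n ^ b + n + 2)) * (n + 1) ^ 2)) ^ 2 ≤
      10 ^ 8 * 2 ^ (10 * b + 40) * n ^ (10 * b + 40) := by
  have h := card_lab_le_poly n b
  have h2 : (n + 3) ^ (10 * b + 40) ≤ (2 * n) ^ (10 * b + 40) := Nat.pow_le_pow_left (by omega) _
  calc Fintype.card (RazUniversal.Lab (Fin n) n (4 * ((n + 1) * (n ^ b + n + 2)) * (n + 1) ^ 2)) ^ 2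
      ≤ (9375 * (n + 3) ^ (5 * b + 20)) ^ 2 := Nat.pow_le_pow_left h 2
    _ = 9375 ^ 2 * (n + 3) ^ (10 * b + 40) := by rw [mul_pow, ← pow_mul]; ring
    _ ≤ 10 ^ 8 * (2 * n) ^ (10 * b + 40) := Nat.mul_le_mul (by norm_num) h2
    _ = 10 ^ 8 * 2 ^ (10 * b + 40) * n ^ (10 * b + 40) := by rw [mul_pow]; ring

/-- The label count is at least `2n` and at least `10` (for `n ≥ 3`). [folklore] -/
theorem card_lab_ge (n b : ℕ) (hn : 3 ≤ n) :
    2 * n ≤ Fintype.card (RazUniversal.Lab (Fin n) n (4 * ((n + 1) * (n ^ b + n + 2)) * (n + 1) ^ 2)) ∧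
    10 ≤ Fintype.card (RazUniversal.Lab (Fin n) n (4 * ((n + 1) * (n ^ b + n + 2)) * (n + 1) ^ 2)) := by
  set W := 4 * ((n + 1) * (n ^ b + n + 2)) * (n + 1) ^ 2 with hW
  have hW4 : 4 ≤ W := by
    have h1 : 1 ≤ (n + 1) * (n ^ b + n + 2) := Nat.one_le_iff_ne_zero.mpr (by positivity)
    have h2 : 1 ≤ (n + 1) ^ 2 := Nat.one_le_pow _ _ (by omega)
    calc 4 = 4 * 1 * 1 := by ring
      _ ≤ W := by rw [hW]; gcongr
  have hle : n + n * W ≤ Fintype.card (RazUniversal.Lab (Fin n) n W) := by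
    rw [RazUniversal.card_lab, Fintype.card_fin]
    exact Nat.le_add_left _ _
  have : 4 * n ≤ n * W := by rw [mul_comm]; exact Nat.mul_le_mul_left _ hW4
  constructor <;> omega

/-! ### The size of a low-degree polynomial in few variables -/

/-- **Sparse size bound.** A polynomial of total degree `≤ t` in `K` variables has at most
`(t+1)^K` monomials, each costing `≤ 2t + 1` gates, so `L ≤ (t+1)^K (2t+2)`.
[cite: Burgisser2000, §2.1] -/
theorem complexity_le_of_totalDegree_le {K t : ℕ} (D₀ : MvPolynomial (Fin K) ℂ)
    (ht : D₀.totalDegree ≤ t) : complexity D₀ ≤ (t + 1) ^ K * (2 * t + 2) := by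
  classical
  have hdeg : ∀ m ∈ D₀.support, (m : Fin K →₀ ℕ).degree ≤ t := fun m hm =>
    (le_totalDegree hm).trans ht
  have hsupp : D₀.support.card ≤ (t + 1) ^ K := by
    have hinj : Set.InjOn (fun m : Fin K →₀ ℕ => fun i => (⟨min (m i) t, by omega⟩ : Fin (t + 1)))
        ↑D₀.support := by
      intro m hm m' hm' h
      ext i
      have hi := congrFun h i
      simp only [Fin.mk.injEq] at hi
      have h1 : m i ≤ t := (Finsupp.le_degree i m).trans (hdeg m hm)
      have h2 : m' i ≤ t := (Finsupp.le_degree i m').trans (hdeg m' hm')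
      rwa [min_eq_left h1, min_eq_left h2] at hi
    calc D₀.support.card ≤ (Finset.univ : Finset (Fin K → Fin (t + 1))).card :=
          Finset.card_le_card_of_injOn _ (fun m _ => Finset.mem_coe.mpr (Finset.mem_univ _)) hinj
      _ = (t + 1) ^ K := by simp
  conv_lhs => rw [D₀.as_sum]
  calc complexity (∑ m ∈ D₀.support, monomial m (coeff m D₀))
      ≤ ∑ m ∈ D₀.support, complexity (monomial m (coeff m D₀)) + D₀.support.card :=
        complexity_finset_sum_le _ _
    _ ≤ ∑ m ∈ D₀.support, (2 * t + 1) + D₀.support.card := by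
        gcongr with m hm
        exact (LowDegree.complexity_monomial_le m _).trans (by have := hdeg m hm; omega)
    _ = D₀.support.card * (2 * t + 2) := by rw [Finset.sum_const, smul_eq_mul]; ring
    _ ≤ (t + 1) ^ K * (2 * t + 2) := Nat.mul_le_mul_right _ hsupp

/-- `(K+1)^K (2K+2) ≤ 2^(3K²)` for `K ≥ 1`. [folklore] -/
theorem size_arith {K : ℕ} (hK : 1 ≤ K) : (K + 1) ^ K * (2 * K + 2) ≤ 2 ^ (3 * (K * K)) := by
  have h1 : K + 1 ≤ 2 ^ K := Nat.lt_two_pow_self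
  have h2 : (K + 1) ^ K ≤ 2 ^ (K * K) := by
    calc (K + 1) ^ K ≤ (2 ^ K) ^ K := Nat.pow_le_pow_left h1 K
      _ = 2 ^ (K * K) := by rw [← pow_mul]
  have h3 : 2 * K + 2 ≤ 2 ^ (K + 1) := by rw [pow_succ]; omega
  calc (K + 1) ^ K * (2 * K + 2) ≤ 2 ^ (K * K) * 2 ^ (K + 1) := Nat.mul_le_mul h2 h3
    _ = 2 ^ (K * K + (K + 1)) := by rw [← pow_add]
    _ ≤ 2 ^ (3 * (K * K)) := Nat.pow_le_pow_right (by norm_num) (by nlinarith)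

/-! ### The refuter's interface: top-degree equations from Raz's polynomial map -/

/-- **Equations from the universal circuit (top degree).** Let `n ≥ 1`, `s = (n+1)(n^b+n+2)`,
`W = 4 s (n+1)²`, and let `e` pick coefficient variables of degree exactly `n`. If a polynomial
`D₀` in those variables is annihilated by Raz's coordinates, `D₀(Γ_e) = 0` in the label ring, then
`D := rename e D₀` vanishes at the coefficient vector of EVERY `f ∈ SmallCircuits ℂ n b` (the top
homogeneous component of `f` has complexity `≤ s`, so its coefficients are `Γ(y)` for some
labelling `y`, Raz 2010 Prop. 3.3). A refuter of `stub_levelOne` may thus look for SMALL `D₀` with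
`D₀ ∘ Γ ≡ 0`. [cite: Raz2010, Prop. 3.3 (p. 158)] -/
theorem vanishes_of_aeval_uCoeff_eq_zero {n b : ℕ} (hn : 1 ≤ n) {ι : Type*}
    (e : ι → degLEMonomials n) (hdeg : ∀ j, ((e j : degLEMonomials n) : Fin n →₀ ℕ).degree = n)
    (D₀ : MvPolynomial ι ℂ)
    (h0 : aeval (fun j => RazUniversal.uCoeff ℂ (Fin n) n
      (4 * ((n + 1) * (n ^ b + n + 2)) * (n + 1) ^ 2) ((e j : degLEMonomials n) : Fin n →₀ ℕ)) D₀ = 0) :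
    ∀ f ∈ SmallCircuits ℂ n b, eval (coeffVector (degLEMonomials n) f) (rename e D₀) = 0 := by
  intro f hf
  have hg : (homogeneousComponent n f).IsHomogeneous n := homogeneousComponent_isHomogeneous _ _
  have hgc : complexity (homogeneousComponent n f) ≤ (n + 1) * (n ^ b + n + 2) := by
    have h1 := Summit.ValiantsHypothesis.ValiantsHypothesis.Theorems.DivisionGapZeroOneTransfer.SqrtCheap.complexity_homogeneousComponent_le
      f hf.1 n
    rw [Fintype.card_fin] at h1
    exact h1.trans (Nat.mul_le_mul_left _ (by have := hf.2; omega))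
  obtain ⟨y, hy⟩ := RazUniversal.exists_eval_uCoeff_eq_coeff (R := ℂ) (σ := Fin n) (r := n)
    (N := 4 * ((n + 1) * (n ^ b + n + 2)) * (n + 1) ^ 2) (s := (n + 1) * (n ^ b + n + 2))
    hn le_rfl hg hgc
  rw [eval_rename]
  have hpt : coeffVector (degLEMonomials n) f ∘ e = fun j => eval y
      (RazUniversal.uCoeff ℂ (Fin n) n (4 * ((n + 1) * (n ^ b + n + 2)) * (n + 1) ^ 2)
        ((e j : degLEMonomials n) : Fin n →₀ ℕ)) := by
    funext j
    simp only [Function.comp_apply, coeffVector_apply]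
    rw [hy, coeff_homogeneousComponent, if_pos (hdeg j)]
  rw [hpt, ← eval_comp_aeval, h0, map_zero]

/-! ### The equations -/

/-- **Equations of polynomial degree for small circuits exist (non-constructively).** For every
size exponent `b` there are `c, n₀` such that for all `n ≥ n₀` some NONZERO polynomial `D` in the
`C(2n,n)` coefficient variables, of total degree `≤ n ^ c`, vanishes at the coefficient vector of
every `f ∈ SmallCircuits ℂ n b` (degree `≤ n`, fan-in-two size `≤ n ^ b`). Proof: the top homogeneous
component of such an `f` has complexity `≤ s = (n+1)(n^b+n+2)` (interpolation), hence its
coefficient vector is a value of Raz's polynomial map `Γ` of the universal circuit-graph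
(`RazUniversal.exists_eval_uCoeff_eq_coeff`), whose `p = poly(n)` edge labels are the parameters
and whose coordinates have degree `≤ 2n - 1`; restricting to `p²` of the `≥ 2^(n-1)` top-degree
coefficients, the multilinear polynomials in them (dimension `2^(p²)`) map into label-polynomials
of degree `≤ p² (2n-1)` (dimension `≤ (p²(2n-1)+1)^p < 2^(p²)`), so one of them is annihilated.
[cite: ForbesShpilkaVolk2018, Def. 1 and §1.1; Raz2010, Prop. 3.2–3.3] -/
theorem exists_equation (b : ℕ) : ∃ c n₀ : ℕ, ∀ n : ℕ, n₀ ≤ n →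
    ∃ D : MvPolynomial (degLEMonomials n) ℂ, D ≠ 0 ∧ D.totalDegree ≤ n ^ c ∧
      complexity D ≤ 2 ^ (n ^ c) ∧
      ∀ f ∈ SmallCircuits ℂ n b, eval (coeffVector (degLEMonomials n) f) D = 0 := by
  classical
  -- the polynomial bound `A n^K` on `p²` and the threshold beyond which `2 A n^K ≤ 2^n`, `A ≤ n`
  set A := 10 ^ 8 * 2 ^ (10 * b + 40) with hA
  set K := 10 * b + 40 with hK
  obtain ⟨n₁, hn₁⟩ := eventually_mul_pow_le_two_pow (2 * A) K
  refine ⟨2 * (K + 1) + 1, max (max n₁ A) 3, fun n hn => ?_⟩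
  have hn₁' : n₁ ≤ n := le_trans (le_max_left _ _) ((le_max_left _ _).trans hn)
  have hnA : A ≤ n := le_trans (le_max_right _ _) ((le_max_left _ _).trans hn)
  have hn3 : 3 ≤ n := (le_max_right _ _).trans hn
  obtain ⟨k, rfl⟩ : ∃ k, n = k + 1 := ⟨n - 1, by omega⟩
  -- parameters of the universal circuit
  set s := (k + 1 + 1) * ((k + 1) ^ b + (k + 1) + 2) with hs
  set W := 4 * s * (k + 1 + 1) ^ 2 with hW
  set p := Fintype.card (RazUniversal.Lab (Fin (k + 1)) (k + 1) W) with hp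
  have hp2 : p ^ 2 ≤ A * (k + 1) ^ K := card_lab_sq_le (k + 1) b hn3
  obtain ⟨hp2n, hp10⟩ := card_lab_ge (k + 1) b hn3
  have hsq_two : p * p ≤ 2 ^ k := by
    have h := hn₁ (k + 1) hn₁'
    have h2k : 2 ^ (k + 1) = 2 * 2 ^ k := by ring
    rw [h2k, mul_assoc] at h
    have h' : A * (k + 1) ^ K ≤ 2 ^ k := Nat.le_of_mul_le_mul_left h (by norm_num)
    calc p * p = p ^ 2 := (pow_two p).symm
      _ ≤ A * (k + 1) ^ K := hp2
      _ ≤ 2 ^ k := h'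
  have hsq_pow : p * p ≤ (k + 1) ^ (K + 1) := by
    calc p * p = p ^ 2 := (pow_two p).symm
      _ ≤ A * (k + 1) ^ K := hp2
      _ ≤ (k + 1) * (k + 1) ^ K := Nat.mul_le_mul_right _ hnA
      _ = (k + 1) ^ (K + 1) := by ring
  -- `p²` distinct monomials of top degree `k + 1`
  obtain ⟨e₁, he₁, hdeg₁⟩ := exists_injective_degree_eq k
  have hcard2 : Fintype.card (Fin k → Fin 2) = 2 ^ k := by simp
  let ι : Fin (p * p) → (Fin k → Fin 2) := fun j =>
    (Fintype.equivFinOfCardEq hcard2).symm (Fin.castLE hsq_two j)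
  have hι : Function.Injective ι := fun j j' h =>
    Fin.castLE_injective hsq_two ((Fintype.equivFinOfCardEq hcard2).symm.injective h)
  let e : Fin (p * p) → degLEMonomials (k + 1) := fun j => ⟨e₁ (ι j), (hdeg₁ (ι j)).le⟩
  have he : Function.Injective e := fun j j' h =>
    hι (he₁ (congrArg Subtype.val h))
  have hdeg : ∀ j, ((e j : degLEMonomials (k + 1)) : Fin (k + 1) →₀ ℕ).degree = k + 1 :=
    fun j => hdeg₁ (ι j)
  -- Raz's coordinates at these monomials, and the dimension count
  let h : Fin (p * p) → MvPolynomial (RazUniversal.Lab (Fin (k + 1)) (k + 1) W) ℂ := fun j =>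
    RazUniversal.uCoeff ℂ (Fin (k + 1)) (k + 1) W (e j : Fin (k + 1) →₀ ℕ)
  have hδ : ∀ j, (h j).totalDegree ≤ 2 * (k + 1) - 1 := fun j =>
    RazUniversal.totalDegree_uCoeff_le _
  have hcount : (Fintype.card (Fin (p * p)) * (2 * (k + 1) - 1) + 1) ^
      Fintype.card (RazUniversal.Lab (Fin (k + 1)) (k + 1) W) < 2 ^ Fintype.card (Fin (p * p)) := by
    rw [Fintype.card_fin, ← hp]
    exact key_ineq hp10 hp2n
  obtain ⟨D₀, hD₀0, hD₀deg, hD₀van⟩ := exists_ne_zero_aeval_eq_zero h hδ hcount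
  rw [Fintype.card_fin] at hD₀deg
  -- transport to the coefficient variables
  have hn1 : 1 ≤ k + 1 := by omega
  have hdegD : (p * p) ≤ (k + 1) ^ (2 * (K + 1) + 1) :=
    hsq_pow.trans (Nat.pow_le_pow_right hn1 (by omega))
  have hsizeD : complexity (rename e D₀) ≤ 2 ^ ((k + 1) ^ (2 * (K + 1) + 1)) := by
    have hp1 : 1 ≤ p * p := Nat.one_le_iff_ne_zero.mpr (by positivity)
    refine (complexity_rename_le_holds' _ _).trans
      (((complexity_le_of_totalDegree_le D₀ hD₀deg).trans (size_arith hp1)).trans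
        (Nat.pow_le_pow_right (by norm_num) ?_))
    calc 3 * (p * p * (p * p)) ≤ (k + 1) * ((k + 1) ^ (K + 1) * (k + 1) ^ (K + 1)) :=
          Nat.mul_le_mul (by omega) (Nat.mul_le_mul hsq_pow hsq_pow)
      _ = (k + 1) ^ (2 * (K + 1) + 1) := by ring
  exact ⟨rename e D₀, fun h0 => hD₀0 (rename_injective e he (by rw [h0, map_zero])),
    (totalDegree_rename_le _ _).trans (hD₀deg.trans hdegD), hsizeD,
    vanishes_of_aeval_uCoeff_eq_zero hn1 e hdeg D₀ hD₀van⟩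

end LowDegreeEquations

open LowDegreeEquations

/-- **Registered stub `stub_lowDegreeEquations`** (crux stmt-ValiantsHypothesis-14610, line
`registered`; STRUCTURE of the open stub `stub_levelOne`): for every size exponent `b`, eventually in
`n`, the coefficient vectors of `SmallCircuits ℂ n b` satisfy a NONZERO polynomial equation of total
degree `≤ n ^ c = polylog(N)^{O(1)}` (of unspecified circuit size). So algebraically natural proofs
against `VP` in FSV's sense exist non-constructively at polynomial DEGREE; what FSV Question 6 /
`stub_levelOne` asks is whether one of them has polynomial SIZE `L(D) ≤ N^a`.
[cite: ForbesShpilkaVolk2018, Def. 1, §1.1 and Question 6] -/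
theorem stub_lowDegreeEquations :
    ∀ b : ℕ, ∃ c n₀ : ℕ, ∀ n : ℕ, n₀ ≤ n →
      ∃ D : MvPolynomial (degLEMonomials n) ℂ, D ≠ 0 ∧ D.totalDegree ≤ n ^ c ∧
        ∀ f ∈ SmallCircuits ℂ n b, MvPolynomial.eval (coeffVector (degLEMonomials n) f) D = 0 := by
  intro b
  obtain ⟨c, n₀, h⟩ := exists_equation b
  refine ⟨c, n₀, fun n hn => ?_⟩
  obtain ⟨D, hD0, hdeg, -, hvan⟩ := h n hn
  exact ⟨D, hD0, hdeg, hvan⟩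

/-- **In FSV's words**: for every `b`, eventually in `n`, there IS an algebraically natural proof
against `SmallCircuits ℂ n b` inside the distinguisher class "total degree `≤ n ^ c`" (no size
bound) — equivalently (FSV Thm. 4) `SmallCircuits ℂ n b` is NOT a succinct hitting set for that
class. [cite: ForbesShpilkaVolk2018, Def. 1 and Thm. 4] -/
theorem exists_isNaturalProof_lowDegree (b : ℕ) : ∃ c n₀ : ℕ, ∀ n : ℕ, n₀ ≤ n →
    (∃ D, IsNaturalProof (degLEMonomials n) (SmallCircuits ℂ n b)
      {D : MvPolynomial (degLEMonomials n) ℂ | D.totalDegree ≤ n ^ c} D) ∧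
    ¬ IsSuccinctHittingSet (degLEMonomials n) (SmallCircuits ℂ n b)
      {D : MvPolynomial (degLEMonomials n) ℂ | D.totalDegree ≤ n ^ c} := by
  obtain ⟨c, n₀, h⟩ := exists_equation b
  refine ⟨c, n₀, fun n hn => ?_⟩
  obtain ⟨D, hD0, hdeg, -, hvan⟩ := h n hn
  have hnat : ∃ D, IsNaturalProof (degLEMonomials n) (SmallCircuits ℂ n b)
      {D : MvPolynomial (degLEMonomials n) ℂ | D.totalDegree ≤ n ^ c} D :=
    ⟨D, hdeg, hD0, hvan⟩
  exact ⟨hnat, (exists_isNaturalProof_iff _ _ _).mp hnat⟩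

/-- **The degree half of level one is met.** For every `b`, eventually in `n`, some nonzero
polynomial of total degree `≤ N = C(2n,n)` — the degree allowance of the level-one distinguishers
`Distinguishers ℂ n 1` — vanishes on the coefficient vectors of all of `SmallCircuits ℂ n b`; its
fan-in-two size is NOT controlled (the linear-algebra witness has up to `2^(poly n)` monomials).
[cite: ForbesShpilkaVolk2018, Question 6] -/
theorem exists_equation_degree_le_choose (b : ℕ) : ∃ n₀ : ℕ, ∀ n : ℕ, n₀ ≤ n →
    ∃ D : MvPolynomial (degLEMonomials n) ℂ, D ≠ 0 ∧ D.totalDegree ≤ Nat.choose (2 * n) n ∧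
      ∀ f ∈ SmallCircuits ℂ n b, eval (coeffVector (degLEMonomials n) f) D = 0 := by
  obtain ⟨c, n₀, h⟩ := exists_equation b
  obtain ⟨n₁, hn₁⟩ := eventually_mul_pow_le_two_pow 1 c
  refine ⟨max (max n₀ n₁) 4, fun n hn => ?_⟩
  obtain ⟨D, hD0, hdeg, -, hvan⟩ := h n (le_trans (le_max_left _ _) ((le_max_left _ _).trans hn))
  refine ⟨D, hD0, hdeg.trans ?_, hvan⟩
  have h1 := hn₁ n (le_trans (le_max_right _ _) ((le_max_left _ _).trans hn))
  rw [one_mul] at h1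
  exact h1.trans (two_pow_le_choose ((le_max_right _ _).trans hn))

/-- **Refuted strengthening of the open stub.** `stub_levelOne` with the SIZE bound on the
distinguisher dropped (keeping only `deg D ≤ N = C(2n,n)`) is FALSE: no size exponent `b` makes
`SmallCircuits ℂ n b` hit all nonzero polynomials of degree `≤ N` eventually. Hence any proof of
`stub_levelOne` must use `L(D) ≤ N`, and any disproof must produce equations of size `≤ N`
(degree alone is free). [cite: ForbesShpilkaVolk2018, Question 6] -/
theorem not_levelOne_without_size_bound :
    ¬ ∃ b n₀ : ℕ, ∀ n : ℕ, n₀ ≤ n →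
      IsSuccinctHittingSet (degLEMonomials n) (SmallCircuits ℂ n b)
        {D : MvPolynomial (degLEMonomials n) ℂ | D.totalDegree ≤ Nat.choose (2 * n) n} := by
  rintro ⟨b, n₀, h⟩
  obtain ⟨n₁, hn₁⟩ := exists_equation_degree_le_choose b
  obtain ⟨D, hD0, hdeg, hvan⟩ := hn₁ (max n₀ n₁) (le_max_right _ _)
  obtain ⟨f, hf, hne⟩ := h (max n₀ n₁) (le_max_left _ _) D hdeg hD0
  exact hne (hvan f hf)

end Summit.ValiantsHypothesis.ValiantsHypothesis.Theorems.BarrierLever.SuccinctHittingSetsForVP
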